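import Literature.AlgebraicGeometry.Resolution.HasseSchmidtDerivatives
import Literature.AlgebraicGeometry.Resolution.MvPolynomialDiffOpFG
import Mathlib.Data.Nat.Choose.Sum
import Mathlib.Data.Finsupp.Weight
import Mathlib.Algebra.Order.Antidiag.Finsupp
import HarnessLib

/-!
# EGA IV₄ Thm. 16.11.2 for affine space: the Hasse–Schmidt derivatives `D^{(α)}`, `|α| ≤ n`, SPAN `Diff^{≤ n}`

Topic: `Literature/AlgebraicGeometry/Resolution` — companion of `HasseSchmidtDerivatives.lean` (Taylor morphism,
`hasseDeriv R α = D^{(α)}`, `HasseSchmidtDiff σ R n` = the `R[x]`-span of the `D^{(α)}`, `|α| ≤ n`, and the PROVED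
inclusion `hasseSchmidtDiff_le_diffOp`), of `DifferentialOperators.lean` (Grothendieck's `IsDiffOpLE` / `diffOp`,
EGA IV₄ 16.8.8 (b)) and of `MvPolynomialDiffOpFG.lean` (`eq_zero_of_isDiffOpLE_of_apply_monomial_eq_zero`: an operator
of order `≤ n` on `R[x_σ]` vanishing on all monomials of degree `≤ n` is zero — the uniqueness half of 16.11.2).

This file DISCHARGES the named fact `hasseSchmidtDiff_eq_diffOp` of `HasseSchmidtDerivatives.lean`
(res-hironaka FACT-LIST F-09): for `σ` FINITE and ANY commutative ring `R`,
`HasseSchmidtDiff σ R n = diffOp R (MvPolynomial σ R) n` — every differential operator of order `≤ n` of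
`R[x_i : i ∈ σ]` relative to `R` is an `R[x]`-linear combination of the `D^{(α)}`, `|α| ≤ n` (EGA IV₄ Thm. 16.11.2:
«si `L` est fini, pour tout entier `m`, les `D_p` tels que `|p| ≤ m` forment une base du `𝒪_U`-Module `Diff^m_{U/S}`»,
here for `U = 𝔸^σ_R → S = Spec R`; the spanning statement is what the tree's `Prop` asserts — freeness is not
restated).

Proof (elementary, from the commutator definition; no modules of principal parts):
* `hasseDeriv_apply_X_pow`, **`hasseDeriv_monomial`** — the multivariate binomial formula
  `D^{(α)}(c·x^β) = (∏_{i ∈ supp α} C(β_i, α_i)) · c · x^{β−α}` (16.11.2.1 «`D_p(z^q) = (q choose p) z^{q−p}`»), by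
  `Finsupp.induction` on `β` and the Leibniz rule `hasseDeriv_mul`; hence `D^{(α)}(x^β) = 0` unless `α ≤ β`
  (`hasseDeriv_monomial_eq_zero_of_not_le`) and `D^{(β)}(c·x^β) = c` (`hasseDeriv_monomial_self`);
* `exists_hasseSchmidtDiff_sub_apply_monomial_eq_zero` — DEGREE PEELING: given any `R`-linear `D`, the operators
  `E_k ∈ HasseSchmidtDiff σ R n` with `E_{k+1} = E_k + Σ_{|α| = k} (D − E_k)(x^α) · D^{(α)}` make `D − E_k` vanish on
  all monomials of degree `< k` (`k ≤ n + 1`), because on degree `k` the matrix `D^{(α)}(x^β)`, `|α| = |β| = k`, is the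
  identity;
* `diffOp_le_hasseSchmidtDiff`: for `D ∈ Diff^{≤ n}`, `D − E_{n+1} ∈ Diff^{≤ n}` kills all monomials of degree `≤ n`,
  so it is `0` by `eq_zero_of_isDiffOpLE_of_apply_monomial_eq_zero`; with `hasseSchmidtDiff_le_diffOp` this is
  `hasseSchmidtDiff_eq_diffOp_of_fintype` and the discharge **`hasseSchmidtDiff_eq_diffOp_holds`**.

## References

* [EGAIV4] A. Grothendieck, J. Dieudonné, ÉGA IV₄, Publ. Math. IHÉS 32 (1967), Thm. 16.11.2 with (16.11.2.1)–(16.11.2.2)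
  (held copy `paper:doi-10-1007-bf02732123`, PDF p.53 l.13–40 = journal p.54; locator audited for F-09 by res-lit-3 /
  res-lit-2, res-hironaka STATUS 2026-08-26 15:14:32Z / 17:11:49Z); Déf. 16.8.1, Prop. 16.8.8 (b).
* [VillamayorU2008ReesDiff] O. Villamayor U., Rev. Mat. Iberoam. 24 (2008) = arXiv:math/0606795, §2.6 («`{Δ^α, 0 ≤ |α| ≤ N}`
  is a basis of the `B`-module of `S`-differential operators on `B` of order `≤ N`»).
-/

noncomputable section

open MvPolynomial

namespace Literature.AlgebraicGeometry.Resolution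

section HasseSpan

variable {σ : Type*} (R : Type*) [CommRing R]

/-! ### Values of the Hasse–Schmidt derivatives on monomials -/

/-- **`D^{(γ)}(x_a^b)`**: equal to `C(b, γ_a) · x_a^{b − γ_a}` if `γ` is supported on `{a}` (i.e. `γ = γ_a · e_a`),
and `0` otherwise (the Taylor expansion `(x_a + u_a)^b` involves the variable `u_a` only).
[cite: EGAIV4, Thm. 16.11.2 (16.11.2.1: D_p(z^q) = (q choose p) z^{q−p})] -/
theorem hasseDeriv_apply_X_pow [DecidableEq σ] (a : σ) (b : ℕ) (γ : σ →₀ ℕ) :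
    hasseDeriv R γ (X a ^ b : MvPolynomial σ R) =
      if γ = Finsupp.single a (γ a) then (b.choose (γ a) : MvPolynomial σ R) * X a ^ (b - γ a) else 0 := by
  rw [hasseDeriv_apply, map_pow, taylor_X, add_comm, add_pow, coeff_sum]
  have hterm : ∀ j ∈ Finset.range (b + 1),
      coeff γ ((X a : MvPolynomial σ (MvPolynomial σ R)) ^ j * C (X a) ^ (b - j) *
            (b.choose j : MvPolynomial σ (MvPolynomial σ R))) =
        if Finsupp.single a j = γ then (b.choose j : MvPolynomial σ R) * X a ^ (b - j) else 0 := by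
    intro j _
    have hC : (X a : MvPolynomial σ (MvPolynomial σ R)) ^ j * C (X a) ^ (b - j) *
          (b.choose j : MvPolynomial σ (MvPolynomial σ R)) =
        C ((b.choose j : MvPolynomial σ R) * X a ^ (b - j)) * X a ^ j := by
      rw [map_mul, map_pow, map_natCast]; ring
    rw [hC, coeff_C_mul, coeff_X_pow]
    split_ifs <;> simp
  rw [Finset.sum_congr rfl hterm]
  split_ifs with hγ
  · rw [Finset.sum_eq_single (γ a)]
    · rw [if_pos hγ.symm]
    · intro j _ hj
      rw [if_neg]
      intro h
      apply hj
      have := congrArg (fun f : σ →₀ ℕ => f a) h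
      simpa using this
    · intro hnot
      rw [Finset.mem_range, not_lt] at hnot
      rw [if_pos hγ.symm, Nat.choose_eq_zero_of_lt (by omega), Nat.cast_zero, zero_mul]
  · refine Finset.sum_eq_zero fun j _ => ?_
    rw [if_neg]
    intro h
    apply hγ
    rw [← h]
    simp

/-- **The multivariate binomial formula for the Hasse–Schmidt derivatives**:
`D^{(α)}(c · x^β) = (∏_{i ∈ supp α} C(β_i, α_i)) · c · x^{β − α}` (truncated subtraction; the binomial product
vanishes as soon as `α ≰ β`). [cite: EGAIV4, Thm. 16.11.2 (16.11.2.1)–(16.11.2.2)] -/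
theorem hasseDeriv_monomial [DecidableEq σ] (α β : σ →₀ ℕ) (c : R) :
    hasseDeriv R α (monomial β c) =
      ((∏ i ∈ α.support, (β i).choose (α i) : ℕ) : MvPolynomial σ R) * monomial (β - α) c := by
  induction β using Finsupp.induction generalizing α with
  | zero =>
    rw [← C_apply, hasseDeriv_apply, taylor_C, coeff_C]
    by_cases hα : α = 0
    · subst hα
      simp
    · rw [if_neg (Ne.symm hα)]
      obtain ⟨i, hi⟩ := Finsupp.support_nonempty_iff.mpr hα
      rw [Finset.prod_eq_zero hi
        (Nat.choose_eq_zero_of_lt (Nat.pos_of_ne_zero (Finsupp.mem_support_iff.mp hi)))]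
      simp
  | single_add a b f ha hb ih =>
    have hfa : f a = 0 := Finsupp.notMem_support_iff.mp ha
    rw [monomial_single_add, hasseDeriv_mul,
      Finset.sum_eq_single (Finsupp.single a (α a), α.erase a)]
    · -- the surviving term `(α_a e_a, α − α_a e_a)`
      rw [hasseDeriv_apply_X_pow, if_pos (by simp), ih]
      simp only [Finsupp.single_eq_same]
      have hprod : (∏ i ∈ α.support, ((Finsupp.single a b + f) i).choose (α i)) =
          b.choose (α a) * ∏ i ∈ (α.erase a).support, (f i).choose ((α.erase a) i) := by
        rw [Finsupp.support_erase]
        have h2 : ∀ i ∈ α.support.erase a,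
            ((Finsupp.single a b + f) i).choose (α i) = (f i).choose ((α.erase a) i) := by
          intro i hi
          have hia : i ≠ a := Finset.ne_of_mem_erase hi
          rw [Finsupp.add_apply, Finsupp.single_eq_of_ne hia, zero_add, Finsupp.erase_ne hia]
        by_cases hmem : a ∈ α.support
        · rw [← Finset.mul_prod_erase _ _ hmem, Finset.prod_congr rfl h2]
          congr 1
          rw [Finsupp.add_apply, Finsupp.single_eq_same, hfa, add_zero]
        · have hα0 : α a = 0 := Finsupp.notMem_support_iff.mp hmem
          rw [Finset.erase_eq_of_notMem hmem] at h2 ⊢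
          rw [hα0, Nat.choose_zero_right, one_mul]
          exact Finset.prod_congr rfl h2
      have hexp : Finsupp.single a (b - α a) + (f - α.erase a) = Finsupp.single a b + f - α := by
        ext i
        by_cases hia : i = a
        · subst hia
          simp only [Finsupp.add_apply, Finsupp.coe_tsub, Pi.sub_apply, Finsupp.single_eq_same,
            Finsupp.erase_same, hfa]
          omega
        · simp only [Finsupp.add_apply, Finsupp.coe_tsub, Pi.sub_apply, Finsupp.single_eq_of_ne hia,
            Finsupp.erase_ne hia]
          omega
      have hmono : (X a : MvPolynomial σ R) ^ (b - α a) * monomial (f - α.erase a) c =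
          monomial (Finsupp.single a b + f - α) c := by
        rw [← monomial_single_add, hexp]
      rw [hprod, Nat.cast_mul, ← hmono]
      ring
    · -- every other term of the Leibniz sum vanishes
      intro p hp hne
      rw [Finset.mem_antidiagonal] at hp
      rw [hasseDeriv_apply_X_pow]
      split_ifs with h1
      · rw [ih]
        have h2a : p.2 a ≠ 0 := by
          intro h0
          apply hne
          have hpa : p.1 a + p.2 a = α a := by
            have := congrArg (fun g : σ →₀ ℕ => g a) hp
            simpa using this
          have hp1 : p.1 = Finsupp.single a (α a) := by
            rw [h1]
            congr 1
            omega
          have hp2 : p.2 = α.erase a := by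
            ext i
            by_cases hia : i = a
            · subst hia
              rw [h0, Finsupp.erase_same]
            · have := congrArg (fun g : σ →₀ ℕ => g i) hp
              simp only [Finsupp.add_apply] at this
              rw [h1, Finsupp.single_eq_of_ne hia, zero_add] at this
              rw [Finsupp.erase_ne hia, this]
          exact Prod.ext hp1 hp2
        rw [Finset.prod_eq_zero (Finsupp.mem_support_iff.mpr h2a)
          (by rw [hfa]; exact Nat.choose_eq_zero_of_lt (Nat.pos_of_ne_zero h2a))]
        simp
      · rw [zero_mul]
    · intro hnot
      exact absurd (Finset.mem_antidiagonal.mpr (Finsupp.single_add_erase a α)) hnot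

/-- `D^{(α)}(c · x^β) = 0` unless `α ≤ β` coordinatewise. [cite: EGAIV4, Thm. 16.11.2 (16.11.2.1)] -/
theorem hasseDeriv_monomial_eq_zero_of_not_le [DecidableEq σ] {α β : σ →₀ ℕ} (h : ¬ α ≤ β) (c : R) :
    hasseDeriv R α (monomial β c) = 0 := by
  rw [hasseDeriv_monomial]
  obtain ⟨i, hi⟩ : ∃ i, β i < α i := by
    by_contra hcon
    push Not at hcon
    exact h (Finsupp.le_def.mpr hcon)
  have hz : (∏ j ∈ α.support, (β j).choose (α j)) = 0 :=
    Finset.prod_eq_zero (Finsupp.mem_support_iff.mpr (by omega : α i ≠ 0)) (Nat.choose_eq_zero_of_lt hi)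
  rw [hz]
  simp

/-- `D^{(β)}(c · x^β) = c`. [cite: EGAIV4, Thm. 16.11.2 (16.11.2.1 with p = q)] -/
theorem hasseDeriv_monomial_self [DecidableEq σ] (β : σ →₀ ℕ) (c : R) :
    hasseDeriv R β (monomial β c) = C c := by
  rw [hasseDeriv_monomial, Finset.prod_eq_one fun i _ => Nat.choose_self _, tsub_self, ← C_apply]
  simp

/-! ### Degree bookkeeping on exponents -/

/-- `α ≤ β ⇒ |α| ≤ |β|`. [folklore] -/
private theorem degree_le_degree_of_le {α β : σ →₀ ℕ} (h : α ≤ β) : α.degree ≤ β.degree := by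
  have hβ : α + (β - α) = β := add_tsub_cancel_of_le h
  have := congrArg Finsupp.degree hβ
  rw [map_add] at this
  omega

/-- `α ≤ β` and `|α| = |β|` force `α = β`. [folklore] -/
private theorem eq_of_le_of_degree_eq {α β : σ →₀ ℕ} (h : α ≤ β) (hd : α.degree = β.degree) : α = β := by
  have hβ : α + (β - α) = β := add_tsub_cancel_of_le h
  have h0 : (β - α).degree = 0 := by
    have := congrArg Finsupp.degree hβ
    rw [map_add, hd] at this
    omega
  rw [Finsupp.degree_eq_zero_iff] at h0
  rw [← hβ, h0, add_zero]

/-- For `σ` a `Fintype`, `Finset.univ.finsuppAntidiag k` is the set of exponents of degree exactly `k`. [folklore] -/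
private theorem mem_finsuppAntidiag_univ_iff [Fintype σ] [DecidableEq σ] {k : ℕ} {α : σ →₀ ℕ} :
    α ∈ (Finset.univ : Finset σ).finsuppAntidiag k ↔ α.degree = k := by
  rw [Finset.mem_finsuppAntidiag, Finsupp.degree_eq_sum]
  simp

/-! ### Degree peeling and the spanning theorem -/

/-- **Degree peeling.** For every `R`-linear endomorphism `D` of `R[x_σ]` (`σ` finite) and every `k ≤ n + 1` there is
`E` in the span of the `D^{(α)}`, `|α| ≤ n`, such that `D − E` vanishes on all monomials of degree `< k`:
`E_{k+1} = E_k + Σ_{|α| = k} (D − E_k)(x^α) · D^{(α)}` works because `D^{(α)}(x^β) = δ_{αβ}` for `|α| = |β|` and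
`D^{(α)}(x^β) = 0` for `|α| > |β|`. [cite: EGAIV4, Thm. 16.11.2 (proof: D = Σ_{|p| ≤ m} a_p D_p is forced by the values on the z^q)] -/
theorem exists_hasseSchmidtDiff_sub_apply_monomial_eq_zero [Fintype σ] [DecidableEq σ] (n : ℕ)
    (D : MvPolynomial σ R →ₗ[R] MvPolynomial σ R) :
    ∀ k : ℕ, k ≤ n + 1 → ∃ E ∈ HasseSchmidtDiff σ R n,
      ∀ β : σ →₀ ℕ, β.degree < k → (D - E) (monomial β 1) = 0
  | 0, _ => ⟨0, Submodule.zero_mem _, fun β hβ => absurd hβ (Nat.not_lt_zero _)⟩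
  | k + 1, hk => by
    obtain ⟨E, hE, hkill⟩ := exists_hasseSchmidtDiff_sub_apply_monomial_eq_zero n D k (by omega)
    refine ⟨E + ∑ α ∈ (Finset.univ : Finset σ).finsuppAntidiag k, (D - E) (monomial α 1) • hasseDeriv R α, ?_, ?_⟩
    · refine Submodule.add_mem _ hE (Submodule.sum_mem _ fun α hα => Submodule.smul_mem _ _ ?_)
      exact hasseDeriv_mem_hasseSchmidtDiff σ R (by rw [mem_finsuppAntidiag_univ_iff.mp hα]; omega)
    · intro β hβ
      have hsplit : (D - (E + ∑ α ∈ (Finset.univ : Finset σ).finsuppAntidiag k, (D - E) (monomial α 1) • hasseDeriv R α))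
            (monomial β 1) =
          (D - E) (monomial β 1) -
            ∑ α ∈ (Finset.univ : Finset σ).finsuppAntidiag k, (D - E) (monomial α 1) * hasseDeriv R α (monomial β 1) := by
        simp only [LinearMap.sub_apply, LinearMap.add_apply, LinearMap.sum_apply, LinearMap.smul_apply,
          smul_eq_mul]
        ring
      rw [hsplit, sub_eq_zero]
      rcases Nat.lt_succ_iff_lt_or_eq.mp hβ with hlt | heq
      · -- degree `< k`: the IH and `|α| = k > |β|`
        rw [hkill β hlt, eq_comm]
        refine Finset.sum_eq_zero fun α hα => ?_
        rw [hasseDeriv_monomial_eq_zero_of_not_le R ?_, mul_zero]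
        intro hle
        have := degree_le_degree_of_le hle
        rw [mem_finsuppAntidiag_univ_iff.mp hα] at this
        omega
      · -- degree `= k`: only `α = β` contributes, with `D^{(β)}(x^β) = 1`
        rw [Finset.sum_eq_single β]
        · rw [hasseDeriv_monomial_self, C_1, mul_one]
        · intro α hα hne
          rw [hasseDeriv_monomial_eq_zero_of_not_le R ?_, mul_zero]
          intro hle
          exact hne (eq_of_le_of_degree_eq hle (by rw [mem_finsuppAntidiag_univ_iff.mp hα, heq]))
        · intro hβ'
          exact absurd (mem_finsuppAntidiag_univ_iff.mpr heq) hβ'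

/-- **`Diff^{≤ n}_{R[x_σ]/R} ⊆ HasseSchmidtDiff σ R n`** for `σ` finite: every differential operator of order `≤ n` is an
`R[x]`-combination of the `D^{(α)}`, `|α| ≤ n`. [cite: EGAIV4, Thm. 16.11.2] -/
theorem diffOp_le_hasseSchmidtDiff [Fintype σ] [DecidableEq σ] (n : ℕ) :
    diffOp R (MvPolynomial σ R) n ≤ HasseSchmidtDiff σ R n := by
  intro D hD
  obtain ⟨E, hE, hkill⟩ :=
    exists_hasseSchmidtDiff_sub_apply_monomial_eq_zero R n D (n + 1) le_rfl
  have hDE : IsDiffOpLE R n (D - E) :=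
    IsDiffOpLE.sub hD (hasseSchmidtDiff_le_diffOp σ R n hE)
  have h0 : D - E = 0 :=
    eq_zero_of_isDiffOpLE_of_apply_monomial_eq_zero n hDE fun β hβ => hkill β (Nat.lt_succ_of_le hβ)
  rw [sub_eq_zero] at h0
  rw [h0]
  exact hE

/-- **EGA IV₄ Thm. 16.11.2 for `𝔸^σ_R`, `σ` finite (spanning form): `HasseSchmidtDiff σ R n = Diff^{≤ n}_{R[x_σ]/R}`.**
[cite: EGAIV4, Thm. 16.11.2] -/
theorem hasseSchmidtDiff_eq_diffOp_of_fintype [Fintype σ] [DecidableEq σ] (n : ℕ) :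
    HasseSchmidtDiff σ R n = diffOp R (MvPolynomial σ R) n :=
  le_antisymm (hasseSchmidtDiff_le_diffOp σ R n) (diffOp_le_hasseSchmidtDiff R n)

end HasseSpan

/-- **Discharge of the named fact `hasseSchmidtDiff_eq_diffOp`** (EGA IV₄ Thm. 16.11.2 for polynomial rings in
finitely many variables over any commutative ring; res-hironaka FACT-LIST F-09). [cite: EGAIV4, Thm. 16.11.2] -/
theorem hasseSchmidtDiff_eq_diffOp_holds : hasseSchmidtDiff_eq_diffOp := by
  intro σ _ _ R _ n
  exact hasseSchmidtDiff_eq_diffOp_of_fintype R n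

end Literature.AlgebraicGeometry.Resolution

end
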